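import Summits.ValiantsHypothesis.ValiantsHypothesis.Theorems.KPlusLogSqLawTridiagonalRealStaticUnitSignTableAbove
import Summits.ValiantsHypothesis.ValiantsHypothesis.Theorems.KPlusLogSqLawTridiagonalRealStaticUnitSturmWindowCount
import Summits.ValiantsHypothesis.ValiantsHypothesis.Theorems.LacunarySymmetroidMatrixDescartesInertiaWindow

/-!
# Route «KPlusLogSqLaw», crux `WeakLifting` (stmt-ValiantsHypothesis-19561) — REAL side of the tridiagonal sector:
# the UNIT-COEFFICIENT sub-sector, ALL SIZES — the INERTIA FLOOR: distinct zeros in a window ≥ |drift of the Sturm count|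

HONEST FRAMING.  Helper theorems (`--supports stmt-ValiantsHypothesis-19561 --as helper`), seat val-sym-lift-p1 (g19), cell `pub-symmetroid`,
2026-08-28; the unconditional ALL-SIZES half of the unit-slice count laws (g18 p638066 / this seat p641687, p642748: EXACT counts for `m ≤ 8`).
Continuants `D_k = pathDet (fun _ => 1) d (fun _ => 1) f k`, Sturm count `V(x) = #{k < m : D_k(x)D_{k+1}(x) < 0}` (= negative inertia index of the
evaluated unit pencil, lift-p2 g15 `SturmJacobi.negIndex_eval_eq_sturmCount`).  MECHANISM: mdr-p2's window inequality
`|ν(F(b)) − ν(F(a))| ≤ Σ_{singular t ∈ (a,b)} corank F(t)` (`Inertia.negIndex_dist_le_sum_corank`, every continuous hermitian family) and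
**`corank_unitPencil_le_one`**: the evaluated unit pencil is an unreduced Jacobi matrix, its kernel is spanned by the continuant vector
(`…UnitPencil.kernel_eq_smul`), so EVERY singular scale has corank exactly… at most `1`.  Proved here (ALL sizes, all exponents):
* **`sturmCount_dist_le_card_posRoots_window`**: `0 < a < b`, no continuant vanishing at `a`, `b` ⇒ `V(b) ≤ V(a) + #{distinct zeros of D_m in (a,b)}`
  and `V(a) ≤ V(b) + #{…}` — any slopes;
* **RECESSIVE FLOOR** (`div_three_le_card_posRoots_unit_interval`): all slopes positive ⇒ `D_m` has AT LEAST `⌊m/3⌋` distinct zeros in `(0,1)`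
  (`V(0⁺) = 0`, `V(1⁻) = ⌊m/3⌋`); **FLOOR THROUGH THE RESONANCE** (`div_three_succ_le_card_posRoots`): at least `⌊(m+1)/3⌋` distinct zeros in
  `(0, b)` for every `b > 1` inside the upper sign-table zone, hence at least `⌊(m+1)/3⌋` distinct positive zeros (`div_three_succ_le_card_posRoots_all`);
* **GENERIC-SCALE FLOOR** (`sturmCount_le_card_posRoots_below`): all slopes positive, `b > 0` with no vanishing continuant ⇒ at least `V(b)` distinct
  zeros in `(0,b)` — the exact laws of sizes `≤ 8` (`= V(b)`) become `≥ V(b)` for every size.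
Located (g18 memo §3; this seat's tools/m7_int_search.py): the floor is attained with EXCESS from `m = 7` (dominant side) and `m = 9` (recessive side) on.
Nothing here is an upper law for the register (α NO MOVER); nothing bears on `WeakLifting` / `TropicalB` (stmt-19771) in their windows, Conjecture B,
the Door-A registers, `MatrixDescartes` (stmt-18050) or VP ≠ VNP.
[this seat; folklore: Sylvester inertia / continuity of eigenvalues, unreduced Jacobi matrices have simple spectrum]
-/

-- `Summit.ValiantsHypothesis.ValiantsHypothesis.…` repeats a component by the D-0017 layout (single-conjunct summit); the name is mandated.
set_option linter.dupNamespace false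
set_option autoImplicit false

namespace Summit.ValiantsHypothesis.ValiantsHypothesis.Theorems.KPlusLogSqLaw
namespace StaticTridiagonalRealUnit

open Real Finset Polynomial Matrix
open Summit.ValiantsHypothesis.ValiantsHypothesis.Theorems.KPlusLogSqLaw.StaticTridiagonalRealPotential (pathDet)

variable (d : ℕ → ℕ) (f : ℕ → ℕ)

/-! ### 1. Corank of the evaluated unit pencil -/

/-- **corank ≤ 1**: at every scale `t > 0` the evaluated unit pencil has rank at least `m − 1` — its kernel lies in the line spanned by the
continuant vector `w_i = (−1)^i D_i(t)/t^{F_i}` (`kernel_eq_smul`). [this file] -/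
theorem corank_unitPencil_le_one (m : ℕ) (t : ℝ) (ht : 0 < t) :
    Fintype.card (Fin m) - (∑ κ, t ^ unitExponent d f m κ • unitLetter m κ).rank ≤ 1 := by
  classical
  set A : Matrix (Fin m) (Fin m) ℝ := ∑ κ, t ^ unitExponent d f m κ • unitLetter m κ with hA
  -- the continuant vector
  set w : Fin m → ℝ := fun i => (-1) ^ (i : ℕ) * (pathDet (fun _ => (1 : ℝ)) d (fun _ => (1 : ℝ)) f i).eval t / t ^ (∑ j ∈ range i, f j)
    with hw
  have hker : LinearMap.ker A.mulVecLin ≤ Submodule.span ℝ {w} := by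
    intro u hu
    rw [LinearMap.mem_ker, Matrix.mulVecLin_apply] at hu
    have h := kernel_eq_smul d f m t ht u hu
    rw [Submodule.mem_span_singleton]
    rcases Nat.eq_zero_or_pos m with hm | hm
    · subst hm
      exact ⟨0, funext fun i => Fin.elim0 i⟩
    · refine ⟨u ⟨0, hm⟩, funext fun i => ?_⟩
      rw [Pi.smul_apply, smul_eq_mul, hw]
      have := h i i.isLt
      simpa using this.symm
  have hfin : Module.finrank ℝ (LinearMap.ker A.mulVecLin) ≤ 1 := by
    calc Module.finrank ℝ (LinearMap.ker A.mulVecLin) ≤ Module.finrank ℝ (Submodule.span ℝ ({w} : Set (Fin m → ℝ))) :=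
          Submodule.finrank_mono hker
      _ ≤ ({w} : Set (Fin m → ℝ)).toFinset.card := finrank_span_le_card _
      _ = 1 := by simp
  have hrn : A.rank + Module.finrank ℝ (LinearMap.ker A.mulVecLin) = Fintype.card (Fin m) := by
    rw [Matrix.rank, LinearMap.finrank_range_add_finrank_ker]; simp
  omega

/-! ### 2. The window inequality in Sturm currency -/

/-- **INERTIA FLOOR ON A WINDOW (all sizes, any exponents)**: `0 < a < b`, no continuant `D_k` (`k ≤ m`) vanishing at `a` or `b` ⇒ the
distinct zeros of `D_m` in `(a, b)` number at least `|V(b) − V(a)|`. [this file] -/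
theorem sturmCount_dist_le_card_posRoots_window (m : ℕ) {a b : ℝ} (ha0 : 0 < a) (hab : a < b)
    (ha : ∀ k, k ≤ m → (pathDet (fun _ => (1 : ℝ)) d (fun _ => (1 : ℝ)) f k).eval a ≠ 0)
    (hb : ∀ k, k ≤ m → (pathDet (fun _ => (1 : ℝ)) d (fun _ => (1 : ℝ)) f k).eval b ≠ 0) :
    (Finset.univ.filter fun k : Fin m =>
        (pathDet (fun _ => (1 : ℝ)) d (fun _ => (1 : ℝ)) f k).eval b * (pathDet (fun _ => (1 : ℝ)) d (fun _ => (1 : ℝ)) f (k + 1)).eval b < 0).card ≤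
      (Finset.univ.filter fun k : Fin m =>
        (pathDet (fun _ => (1 : ℝ)) d (fun _ => (1 : ℝ)) f k).eval a * (pathDet (fun _ => (1 : ℝ)) d (fun _ => (1 : ℝ)) f (k + 1)).eval a < 0).card +
      (((pathDet (fun _ => (1 : ℝ)) d (fun _ => (1 : ℝ)) f m).roots.toFinset).filter (fun t => a < t ∧ t < b)).card ∧
    (Finset.univ.filter fun k : Fin m =>
        (pathDet (fun _ => (1 : ℝ)) d (fun _ => (1 : ℝ)) f k).eval a * (pathDet (fun _ => (1 : ℝ)) d (fun _ => (1 : ℝ)) f (k + 1)).eval a < 0).card ≤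
      (Finset.univ.filter fun k : Fin m =>
        (pathDet (fun _ => (1 : ℝ)) d (fun _ => (1 : ℝ)) f k).eval b * (pathDet (fun _ => (1 : ℝ)) d (fun _ => (1 : ℝ)) f (k + 1)).eval b < 0).card +
      (((pathDet (fun _ => (1 : ℝ)) d (fun _ => (1 : ℝ)) f m).roots.toFinset).filter (fun t => a < t ∧ t < b)).card := by
  classical
  have hS := unitLetter_isSymm m
  have hdet : ∀ x : ℝ, (∑ κ, x ^ unitExponent d f m κ • unitLetter m κ).det = (pathDet (fun _ => (1 : ℝ)) d (fun _ => (1 : ℝ)) f m).eval x := by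
    intro x
    rw [unitPencil_eq_ctPath, Summit.ValiantsHypothesis.ValiantsHypothesis.Theorems.KPlusLogSqLaw.SturmJacobi.det_evalPath]
  -- `D_m` is not the zero polynomial
  have hP : pathDet (fun _ => (1 : ℝ)) d (fun _ => (1 : ℝ)) f m ≠ 0 := fun h0 => hb m le_rfl (by rw [h0, eval_zero])
  set T := (pathDet (fun _ => (1 : ℝ)) d (fun _ => (1 : ℝ)) f m).roots.toFinset with hT
  have hwin := Summit.ValiantsHypothesis.ValiantsHypothesis.Theorems.LacunarySymmetroidMatrixDescartes.Inertia.negIndex_dist_le_sum_corank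
    (fun x => ∑ κ, x ^ unitExponent d f m κ • unitLetter m κ)
    (Summit.ValiantsHypothesis.ValiantsHypothesis.Theorems.LacunarySymmetroidMatrixDescartes.Inertia.continuous_pencil_entry _ _)
    (Summit.ValiantsHypothesis.ValiantsHypothesis.Theorems.LacunarySymmetroidMatrixDescartes.Inertia.isHermitian_pencil _ _ hS)
    T hab.le (fun x _ hx => by rw [hT, Multiset.mem_toFinset, mem_roots hP, IsRoot.def, ← hdet]; exact hx)
    (by rw [hdet]; exact ha m le_rfl) (by rw [hdet]; exact hb m le_rfl)
  -- coranks are at most one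
  have hcor : ∑ t ∈ T.filter (fun t => a < t ∧ t < b), (Fintype.card (Fin m) - (∑ κ, t ^ unitExponent d f m κ • unitLetter m κ).rank) ≤
      (T.filter (fun t => a < t ∧ t < b)).card := by
    calc ∑ t ∈ T.filter (fun t => a < t ∧ t < b), (Fintype.card (Fin m) - (∑ κ, t ^ unitExponent d f m κ • unitLetter m κ).rank)
        ≤ ∑ t ∈ T.filter (fun t => a < t ∧ t < b), 1 :=
          Finset.sum_le_sum fun t ht => corank_unitPencil_le_one d f m t (ha0.trans (Finset.mem_filter.1 ht).2.1)
      _ = (T.filter (fun t => a < t ∧ t < b)).card := by simp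
  -- negative indices are Sturm counts (lift-p2 g15)
  have hνa := Summit.ValiantsHypothesis.ValiantsHypothesis.Theorems.KPlusLogSqLaw.SturmJacobi.negIndex_eval_eq_sturmCount
    (fun _ => (1 : ℝ)) d (fun _ => (1 : ℝ)) f m (x := a) ha
  have hνb := Summit.ValiantsHypothesis.ValiantsHypothesis.Theorems.KPlusLogSqLaw.SturmJacobi.negIndex_eval_eq_sturmCount
    (fun _ => (1 : ℝ)) d (fun _ => (1 : ℝ)) f m (x := b) hb
  have ea : Fintype.card {j // (Summit.ValiantsHypothesis.ValiantsHypothesis.Theorems.LacunarySymmetroidMatrixDescartes.Inertia.isHermitian_pencil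
      (unitExponent d f m) (unitLetter m) hS a).eigenvalues j < 0} =
      (Finset.univ.filter fun k : Fin m =>
        (pathDet (fun _ => (1 : ℝ)) d (fun _ => (1 : ℝ)) f k).eval a * (pathDet (fun _ => (1 : ℝ)) d (fun _ => (1 : ℝ)) f (k + 1)).eval a < 0).card := by
    rw [negIndex_congr (unitPencil_eq_ctPath d f m a) _
      (Summit.ValiantsHypothesis.ValiantsHypothesis.Theorems.KPlusLogSqLaw.SturmJacobi.ctPathSymm_isHermitian _ _ m)]
    exact hνa
  have eb : Fintype.card {j // (Summit.ValiantsHypothesis.ValiantsHypothesis.Theorems.LacunarySymmetroidMatrixDescartes.Inertia.isHermitian_pencil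
      (unitExponent d f m) (unitLetter m) hS b).eigenvalues j < 0} =
      (Finset.univ.filter fun k : Fin m =>
        (pathDet (fun _ => (1 : ℝ)) d (fun _ => (1 : ℝ)) f k).eval b * (pathDet (fun _ => (1 : ℝ)) d (fun _ => (1 : ℝ)) f (k + 1)).eval b < 0).card := by
    rw [negIndex_congr (unitPencil_eq_ctPath d f m b) _
      (Summit.ValiantsHypothesis.ValiantsHypothesis.Theorems.KPlusLogSqLaw.SturmJacobi.ctPathSymm_isHermitian _ _ m)]
    exact hνb
  obtain ⟨h1, h2⟩ := hwin
  rw [ea, eb] at h1 h2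
  constructor <;> omega

/-! ### 3. Floors for one-signed designs -/

/-- **GENERIC-SCALE FLOOR (all sizes)**: all slopes positive, `b > 0` with no continuant vanishing at `b` ⇒ the distinct zeros of `D_m` in
`(0, b)` number at least `V(b)` (small scales are positive definite: `V(b/4 ∧ 1/4) = 0`). [this file] -/
theorem sturmCount_le_card_posRoots_below (m : ℕ) {b : ℝ} (hb0 : 0 < b)
    (hslope : ∀ k, k + 1 < m → d k + d (k + 1) < 2 * f k)
    (hb : ∀ k, k ≤ m → (pathDet (fun _ => (1 : ℝ)) d (fun _ => (1 : ℝ)) f k).eval b ≠ 0) :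
    (Finset.univ.filter fun k : Fin m =>
        (pathDet (fun _ => (1 : ℝ)) d (fun _ => (1 : ℝ)) f k).eval b * (pathDet (fun _ => (1 : ℝ)) d (fun _ => (1 : ℝ)) f (k + 1)).eval b < 0).card ≤
      (((pathDet (fun _ => (1 : ℝ)) d (fun _ => (1 : ℝ)) f m).roots.toFinset).filter (fun t => 0 < t ∧ t < b)).card := by
  classical
  -- the small scale `a = min (b/4) (1/4)`
  set a : ℝ := min (b / 4) (1 / 4) with ha_def
  have ha0 : 0 < a := by rw [ha_def]; exact lt_min (by linarith) (by norm_num)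
  have ha4 : a ≤ 1 / 4 := min_le_right _ _
  have hab : a < b := lt_of_le_of_lt (min_le_left _ _) (by linarith)
  have hposA : ∀ x, 0 < x → x ≤ a → ∀ k, k ≤ m → 0 < (pathDet (fun _ => (1 : ℝ)) d (fun _ => (1 : ℝ)) f k).eval x := by
    intro x hx hxa k hk
    rcases Nat.eq_zero_or_pos k with rfl | hk0
    · rw [(eval_unit_zero_one d f x).1]; exact one_pos
    · obtain ⟨k', rfl⟩ : ∃ k', k = k' + 1 := ⟨k - 1, by omega⟩
      exact (continuant_pos_of_le_quarter d f m x hx (hxa.trans ha4) hslope k' (by omega)).1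
  have hwin := (sturmCount_dist_le_card_posRoots_window d f m ha0 hab (fun k hk => (hposA a ha0 le_rfl k hk).ne') hb).1
  have hVa : (Finset.univ.filter fun k : Fin m =>
      (pathDet (fun _ => (1 : ℝ)) d (fun _ => (1 : ℝ)) f k).eval a * (pathDet (fun _ => (1 : ℝ)) d (fun _ => (1 : ℝ)) f (k + 1)).eval a < 0).card = 0 := by
    rw [Finset.card_eq_zero, Finset.filter_eq_empty_iff]
    intro k _
    exact not_lt.2 (mul_pos (hposA a ha0 le_rfl k (by omega)) (hposA a ha0 le_rfl (k + 1) (by omega))).le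
  have hsub : ((pathDet (fun _ => (1 : ℝ)) d (fun _ => (1 : ℝ)) f m).roots.toFinset).filter (fun t => a < t ∧ t < b) ⊆
      ((pathDet (fun _ => (1 : ℝ)) d (fun _ => (1 : ℝ)) f m).roots.toFinset).filter (fun t => 0 < t ∧ t < b) := by
    intro t ht
    rw [Finset.mem_filter] at ht ⊢
    exact ⟨ht.1, ha0.trans ht.2.1, ht.2.2⟩
  have := Finset.card_le_card hsub
  omega

/-- **RECESSIVE FLOOR (all sizes, all exponents)**: every unit design with all edge slopes positive has AT LEAST `⌊m/3⌋` distinct zeros of `D_m`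
in `(0,1)` (exactly `⌊m/3⌋` for `m ≤ 8`, p641687; strictly more is possible from `m = 9` on). [this file] -/
theorem div_three_le_card_posRoots_unit_interval (m : ℕ) (hslope : ∀ k, k + 1 < m → d k + d (k + 1) < 2 * f k) :
    m / 3 ≤ (((pathDet (fun _ => (1 : ℝ)) d (fun _ => (1 : ℝ)) f m).roots.toFinset).filter (fun t => 0 < t ∧ t < 1)).card := by
  classical
  -- a scale `b` just below `1` carrying the lower sign table
  have hev : ∀ᶠ x in nhdsWithin (1 : ℝ) (Set.Iio 1), ∀ k ∈ range (m + 1),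
      0 < (if k % 6 < 3 then (1 : ℝ) else -1) * (pathDet (fun _ => (1 : ℝ)) d (fun _ => (1 : ℝ)) f k).eval x :=
    (Finset.eventually_all (range (m + 1))).2 fun k hk =>
      eventually_signTable_near_one d f m hslope k (by rw [mem_range] at hk; omega)
  obtain ⟨δ, hδ, hnear⟩ := exists_delta_of_eventually hev
  set b : ℝ := 1 - min δ 1 / 2 with hb_def
  have hmin : 0 < min δ 1 := lt_min hδ one_pos
  have hb0 : 0 < b := by rw [hb_def]; have := min_le_right δ 1; linarith
  have hb1 : b < 1 := by rw [hb_def]; linarith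
  have hbδ : 1 - δ < b := by rw [hb_def]; have := min_le_left δ 1; linarith
  obtain ⟨hV, hbne⟩ := sturmCount_of_signTable d f m b (fun k hk => hnear b hbδ hb1 k (by rw [mem_range]; omega))
  have hfloor := sturmCount_le_card_posRoots_below d f m hb0 hslope hbne
  rw [hV] at hfloor
  have hsub : ((pathDet (fun _ => (1 : ℝ)) d (fun _ => (1 : ℝ)) f m).roots.toFinset).filter (fun t => 0 < t ∧ t < b) ⊆
      ((pathDet (fun _ => (1 : ℝ)) d (fun _ => (1 : ℝ)) f m).roots.toFinset).filter (fun t => 0 < t ∧ t < 1) := by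
    intro t ht
    rw [Finset.mem_filter] at ht ⊢
    exact ⟨ht.1, ht.2.1, ht.2.2.trans hb1⟩
  exact hfloor.trans (Finset.card_le_card hsub)

/-- **FLOOR THROUGH THE RESONANCE (all sizes)**: all slopes positive ⇒ there is `δ > 0` such that for every `b ∈ (1, 1 + δ)` the distinct zeros
of `D_m` in `(0, b)` number at least `⌊(m+1)/3⌋` (`V(1⁺) = ⌊(m+1)/3⌋`, `…UnitSignTableAbove`). [this file] -/
theorem div_three_succ_le_card_posRoots (m : ℕ) (hslope : ∀ k, k + 1 < m → d k + d (k + 1) < 2 * f k) :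
    ∃ δ > 0, ∀ b, 1 < b → b < 1 + δ →
      (m + 1) / 3 ≤ (((pathDet (fun _ => (1 : ℝ)) d (fun _ => (1 : ℝ)) f m).roots.toFinset).filter (fun t => 0 < t ∧ t < b)).card := by
  obtain ⟨δ, hδ, htab⟩ := exists_sturmCount_above_one d f m hslope
  refine ⟨δ, hδ, fun b hb1 hbδ => ?_⟩
  obtain ⟨hV, hbne⟩ := htab b hb1 hbδ
  have h := sturmCount_le_card_posRoots_below d f m (one_pos.trans hb1) hslope hbne
  rw [hV] at h
  exact h

/-- **TOTAL FLOOR (all sizes)**: every unit design with all edge slopes positive has at least `⌊(m+1)/3⌋` distinct positive determinant zeros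
(`⌊m/3⌋` below the resonance and the resonance itself when `m ≡ 2 (mod 3)`). [this file] -/
theorem div_three_succ_le_card_posRoots_all (m : ℕ) (hslope : ∀ k, k + 1 < m → d k + d (k + 1) < 2 * f k) :
    (m + 1) / 3 ≤ (((pathDet (fun _ => (1 : ℝ)) d (fun _ => (1 : ℝ)) f m).roots.toFinset).filter (fun t => 0 < t)).card := by
  classical
  obtain ⟨δ, hδ, h⟩ := div_three_succ_le_card_posRoots d f m hslope
  have hb := h (1 + δ / 2) (by linarith) (by linarith)
  refine hb.trans (Finset.card_le_card fun t ht => ?_)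
  rw [Finset.mem_filter] at ht ⊢
  exact ⟨ht.1, ht.2.1⟩

end StaticTridiagonalRealUnit
end Summit.ValiantsHypothesis.ValiantsHypothesis.Theorems.KPlusLogSqLaw
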